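import Summits.CriticalPhenomena.CardyFormulaZ2.Theses.CardyIKTransport
import Summits.CriticalPhenomena.CardyFormulaZ2.Theses.CardyDiluteOrbit
import Summits.CriticalPhenomena.CardyFormulaZ2.Theorems.IKMixedBoxCrossing.Negative.IKMixedBoxCrossingSmallModels
import Summits.CriticalPhenomena.CardyFormulaZ2.Theorems.IKMixedBoxCrossing.Negative.IKMixedBoxCrossingNoFKG
import Summits.CriticalPhenomena.CardyFormulaZ2.Theorems.IKMixedBoxCrossing.Negative.IKMixedBoxCrossingNoBondFKG
import Summits.CriticalPhenomena.CardyFormulaZ2.Theorems.CardyIKTransportIKLinearTransportStubPinnedExchange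
import Summits.CriticalPhenomena.CardyFormulaZ2.Theorems.CardyIKTransportIKLinearTransportStubTriLawOfEmpty
import Summits.CriticalPhenomena.CardyFormulaZ2.Theorems.CardyIKTransportIKLinearTransportStubCouplingToLimitsEvents
import Summits.CriticalPhenomena.CardyFormulaZ2.Theorems.CardyIKTransportIKQuarterTurn
import Literature.Probability.Percolation.TriThetaHalf
import Literature.Probability.LatticeModels.CellGridSaddlePercolationProofs

/-!
# Vocabulary of the line `paired-mirror-exploration` for the crux `IKMixedBoxCrossing` (stmt-CriticalPhenomena-5911)

Definitions-only support file of the lead's registered skeleton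
(`Cruxes/IKMixedBoxCrossing/Lines/paired-mirror-exploration.lean`, `ledger skeleton check` OK 2026-08-16, seven registered
stubs `stub_patternLocality`, `stub_duality`, `stub_quarterTurn`, `stub_monotone`, `stub_honeycombRSW`,
`stub_shearedMirrorDoubling`, `stub_patternLayer`).  It carries, sorry-free, the skeleton's VOCABULARY (`pLR`, `pTB`,
`IsoCols`, `HcCols`) over the LANDED gauge vocabulary of the sibling crux stmt-5076
(`Theorems/CardyIKTransportIKLinearTransportLine.lean`: `Ω`, `μIK`, `parSet`/`blackSet`/`antiSet`, `obs`, `blackEdges`,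
`lrCross`, `tbCross` — byte-identical in body to the crux's `let`s, so `iff_cbox` is a definitional unfolding), the seven stub
STATEMENTS as named `Prop`s, the proved lever `paired_symmetrisation` (Smirnov's conditioning step without independence or
Harris, for an orientation-reversing measure-preserving involution), the proved glue (`pLR_square_univ = 1/2`,
`isotropicRSW_of`, the `n = 1` datum through the landed `Negative.pH_one_zero_zero`) and the conditional composition
`IKMixedBoxCrossing_of_stubs` concluding BOTH copies of the decl by name — so that the stub helper files
`Theorems/CardyIKTransportIKMixedBoxCrossingStub<Name>.lean` (each proving `theorem stub_<name> : <statement>` by name,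
`--supports stmt-CriticalPhenomena-5911`) and the closing skeleton share ONE copy of every object.  Nothing is asserted: every
`def … : Prop` is a statement the LINE POSITS (a parametrised sub-goal of the crux, to be proved by a registered stub or by the
glue), not a literature fact, never to be relocated.

The line: FKG-free RSW for the column-mixed isotropic-IK / honeycomb family, uniformly in the column pattern `S`, by
Smirnov's symmetric-domain doubling run on PAIRS of explorations under the exact sheared reflection `Ψ_S` (vertical, every
`S`), reflection positivity of the plaquette field w.r.t. `Ψ_S` for the junction, the two pure media (isotropic: iterated
vertical doubling + quarter turn; honeycomb: the tree's `tri_rsw_half_holds`) and an `∀S` layer (squares + wide gluing).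
Disproof used: `Negative.iff_named`, `iKMixedBoxCrossing_false_without_n_pos` (`1 ≤ n` kept), `pH_one_zero_zero` (used),
`c_le_quarter`, `colourField_not_positivelyAssociated` / `bondField_not_positivelyAssociated` (no stub uses association).
-/

noncomputable section

namespace Summit.CriticalPhenomena.CardyFormulaZ2.Cruxes.IKMixedBoxCrossing.PairedMirrorExploration

open scoped Classical
open MeasureTheory
open Literature.Probability.Percolation Literature.Probability.LatticeModels
open Summit.CriticalPhenomena.CardyFormulaZ2.Theorems.IKLinearTransport.PinnedDiagramExchange
  (Ω μIK parSet blackSet antiSet Obs obs νmix blackEdges lrCross tbCross)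

/-! ## §1 Crossing probabilities of every box, and the definitional bridge to the crux -/

/-- `P_S[black LR crossing of the w × h box at (a,b)]` (box `[a, a+w) × [b, b+h)`). -/
def pLR (S : Set ℤ) (a b : ℤ) (w h : ℕ) : ℝ := μIK.real (obs S ⁻¹' lrCross a b w h)

/-- `P_S[black BT crossing of the w × h box at (a,b)]`. -/
def pTB (S : Set ℤ) (a b : ℤ) (w h : ℕ) : ℝ := μIK.real (obs S ⁻¹' tbCross a b w h)

/-- The two copies of the crux decl (routes CardyDiluteOrbit / CardyIKTransport) are definitionally equal. -/
theorem diluteOrbit_iff_transport :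
    Summit.CriticalPhenomena.CardyFormulaZ2.Theses.CardyDiluteOrbit.IKMixedBoxCrossing ↔
      Summit.CriticalPhenomena.CardyFormulaZ2.Theses.CardyIKTransport.IKMixedBoxCrossing :=
  Iff.rfl

/-- BRIDGE (definitional): the crux (item's home decl), verbatim, is the aspect-ratio-2 case of `pLR`/`pTB`. -/
theorem iff_cbox :
    Summit.CriticalPhenomena.CardyFormulaZ2.Theses.CardyDiluteOrbit.IKMixedBoxCrossing ↔
      ∃ c : ℝ, 0 < c ∧ ∀ S : Set ℤ, ∀ n : ℕ, 1 ≤ n → ∀ a b : ℤ,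
        c ≤ pLR S a b (2 * n) n ∧ c ≤ pTB S a b n (2 * n) := by
  simp only [Summit.CriticalPhenomena.CardyFormulaZ2.Theses.CardyDiluteOrbit.IKMixedBoxCrossing, pLR, pTB,
    lrCross, tbCross, obs, blackEdges, blackSet, antiSet, parSet, μIK, Set.preimage_setOf_eq,
    Set.mem_setOf_eq, Nat.cast_mul, Nat.cast_ofNat]

/-- The same bridge for the CardyIKTransport copy of the decl. -/
theorem iff_cbox_transport :
    Summit.CriticalPhenomena.CardyFormulaZ2.Theses.CardyIKTransport.IKMixedBoxCrossing ↔
      ∃ c : ℝ, 0 < c ∧ ∀ S : Set ℤ, ∀ n : ℕ, 1 ≤ n → ∀ a b : ℤ,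
        c ≤ pLR S a b (2 * n) n ∧ c ≤ pTB S a b n (2 * n) :=
  diluteOrbit_iff_transport.symm.trans iff_cbox

/-- All cell columns `a ≤ x < a + w` are isotropic (`S`-)columns: the box is ISOTROPIC-PURE. -/
def IsoCols (S : Set ℤ) (a : ℤ) (w : ℕ) : Prop := ∀ x : ℤ, a ≤ x → x < a + w → x ∈ S

/-- No cell column `a ≤ x < a + w` is an `S`-column: the box is HONEYCOMB-PURE (site percolation on `𝕋`
drawn with anti-diagonals). -/
def HcCols (S : Set ℤ) (a : ℤ) (w : ℕ) : Prop := ∀ x : ℤ, a ≤ x → x < a + w → x ∉ S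

/-! ## §2 The lever, PROVED: paired symmetrisation -/

/-- PAIRED SYMMETRISATION (the lever): for a measure-preserving `Φ`, a `Φ`-equivariant finite family `E i`
(`Φ ⁻¹' E (i⋆) = E i`, `⋆` an involution) and events `B i` with the pathwise duality `E i ⊆ B i ∪ Φ ⁻¹' B (i⋆)`,
`∑ P(E i) ≤ 2 ∑ P(E i ∩ B i)`. -/
theorem paired_symmetrisation {Ω' : Type*} [MeasurableSpace Ω'] (P : Measure Ω') [IsProbabilityMeasure P]
    (Φ : Ω' → Ω') (hΦ : MeasurePreserving Φ P P) {ι : Type*} (s : Finset ι) (star : ι → ι)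
    (hstar : ∀ i ∈ s, star i ∈ s) (hinv : ∀ i, star (star i) = i)
    (E B : ι → Set Ω') (hE : ∀ i, MeasurableSet (E i)) (hB : ∀ i, MeasurableSet (B i))
    (hΦE : ∀ i, Φ ⁻¹' (E (star i)) = E i)
    (hdual : ∀ i ∈ s, E i ⊆ B i ∪ Φ ⁻¹' (B (star i))) :
    ∑ i ∈ s, P.real (E i) ≤ 2 * ∑ i ∈ s, P.real (E i ∩ B i) := by
  have step1 : ∀ i ∈ s, P.real (E i) ≤ P.real (E i ∩ B i) + P.real (E (star i) ∩ B (star i)) := by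
    intro i hi
    have hsub : E i ⊆ (E i ∩ B i) ∪ Φ ⁻¹' (E (star i) ∩ B (star i)) := by
      intro ω hω
      rcases hdual i hi hω with h | h
      · exact Or.inl ⟨hω, h⟩
      · have hω' : ω ∈ Φ ⁻¹' (E (star i)) := by rw [hΦE]; exact hω
        exact Or.inr ⟨hω', h⟩
    calc P.real (E i) ≤ P.real ((E i ∩ B i) ∪ Φ ⁻¹' (E (star i) ∩ B (star i))) := measureReal_mono hsub
      _ ≤ P.real (E i ∩ B i) + P.real (Φ ⁻¹' (E (star i) ∩ B (star i))) := measureReal_union_le _ _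
      _ = P.real (E i ∩ B i) + P.real (E (star i) ∩ B (star i)) := by
        congr 1
        rw [measureReal_def, measureReal_def, hΦ.measure_preimage ((hE _).inter (hB _)).nullMeasurableSet]
  have step2 : ∑ i ∈ s, P.real (E (star i) ∩ B (star i)) = ∑ i ∈ s, P.real (E i ∩ B i) :=
    Finset.sum_nbij' star star hstar hstar (fun i _ => hinv i) (fun i _ => hinv i) (fun _ _ => rfl)
  calc ∑ i ∈ s, P.real (E i) ≤ ∑ i ∈ s, (P.real (E i ∩ B i) + P.real (E (star i) ∩ B (star i))) :=
        Finset.sum_le_sum step1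
    _ = ∑ i ∈ s, P.real (E i ∩ B i) + ∑ i ∈ s, P.real (E (star i) ∩ B (star i)) := Finset.sum_add_distrib
    _ = 2 * ∑ i ∈ s, P.real (E i ∩ B i) := by rw [step2]; ring

/-! ## §3 The seven stub STATEMENTS (named `Prop`s) -/

/-- STUB 1 statement — PATTERN LOCALITY (every `S`): the crossing probabilities of the `w × h` box at
`(a, b)` depend on `(S, a, b)` only through the column pattern `i ↦ (a + i ∈ S)`, `i < w`.  Content:
horizontal re-anchoring of the gauge (a `μIK`-preserving bit map lifting the horizontal shift of `obs`, as the
landed `exists_lift_vshift` does vertically) + vertical stationarity (`nuMix_map_vshift`) + locality of the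
box events (they read `blackSet` on the box cells and `antiSet` on the faces with lower-left cell in columns
`a … a+w-2` and rows `b … b+h-2`; the box marginal of the colours is the free plaquette field of the box,
which reads the interior face types only).
  A statement to be proved (registered stub / skeleton glue), not asserted here. -/
def PatternLocality : Prop :=
  ∀ (S S' : Set ℤ) (a a' b b' : ℤ) (w h : ℕ), (∀ i : ℕ, i < w → (a + i ∈ S ↔ a' + i ∈ S')) →
    pLR S a b w h = pLR S' a' b' w h ∧ pTB S a b w h = pTB S' a' b' w h

/-- STUB 2 statement — DUALITY (every `S`): for `w, h ≥ 2` exactly one of {black LR, white TB} occurs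
(Hex lemma of the one-diagonal-per-face cell triangulation, tree `cellCrossing_duality_holds`), and the
`μIK`-preserving flip of the column signs `A ↦ Aᶜ` swaps black and white and fixes the diagonals, so
`P_S[LR(w×h)] + P_S[TB(w×h)] = 1`.  (`2 ≤ w`, `2 ≤ h` are load-bearing: in the bond reading a 1-wide box
is LR-crossed surely.).
  A statement to be proved (registered stub / skeleton glue), not asserted here. -/
def Duality : Prop :=
  ∀ (S : Set ℤ) (a b : ℤ) (w h : ℕ), 2 ≤ w → 2 ≤ h → pLR S a b w h + pTB S a b w h = 1

/-- STUB 3 statement — QUARTER TURN of the isotropic gauge (landed bit bijection `IKQuarterTurn.Φ`,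
`obs_Φ`, `blackEdges_rot`): the BT crossing of the `w × h` box at the origin is carried onto the LR
crossing of the `h × w` box `[1-h, 0] × [0, w)` (bottom row ↦ right column, top row ↦ left column).
  A statement to be proved (registered stub / skeleton glue), not asserted here. -/
def QuarterTurn : Prop :=
  ∀ w h : ℕ, pTB Set.univ 0 0 w h = pLR Set.univ (1 - (h : ℤ)) 0 h w

/-- STUB 4 statement — MONOTONICITY (every `S`): crossing a longer box the long way is harder — a LR
crossing of the wider box, stopped at its first visit to column `a + w - 1`, is a LR crossing of the narrower
one (open edges join cells at sup-distance `1`); likewise for heights.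
  A statement to be proved (registered stub / skeleton glue), not asserted here. -/
def Monotone' : Prop :=
  (∀ (S : Set ℤ) (a b : ℤ) (w w' h : ℕ), 1 ≤ w → w ≤ w' → pLR S a b w' h ≤ pLR S a b w h) ∧
  (∀ (S : Set ℤ) (a b : ℤ) (w h h' : ℕ), 1 ≤ h → h ≤ h' → pTB S a b w h' ≤ pTB S a b w h)

/-- STUB 5 target — HONEYCOMB-PURE BOXES are crossed the long way, uniformly: the `S = ∅` member of the
family is site percolation on `𝕋 = ℤ² + (1,-1)` (`stub_TriLawOfEmpty`), the `2n × n` box is the lattice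
parallelogram `rectangle (2n-1) (n-1)`, and `tri_rsw_half_holds` (aspect ratio `3`, width antitonicity)
bounds its crossing probability below; the transpose automorphism of `𝕋` gives the tall box.
  A statement to be proved (registered stub / skeleton glue), not asserted here. -/
def HoneycombRSW : Prop :=
  ∃ c : ℝ, 0 < c ∧ ∀ (S : Set ℤ) (n : ℕ) (a b : ℤ), 1 ≤ n →
    (HcCols S a (2 * n) → c ≤ pLR S a b (2 * n) n) ∧ (HcCols S a n → c ≤ pTB S a b n (2 * n))

/-- STUB 6 statement — SHEARED-MIRROR VERTICAL DOUBLING, EVERY `S` (the lever): with `j(x)` = number of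
honeycomb seams (interior face columns `s ∉ S`) of the box strictly left of column `x`, the map
`Ψ_S (x, y) = (x, 2b − 2 − y − j(x))` is an involution and — with the colour flip and the coin relabelling —
an EXACT automorphism of the percolation structure of `μIK` for every `S`; the staircase region
`R' = ⋃_x {x} × [b−h−1−j(x), b+h−1]` is `Ψ_S`-invariant, contains the box `R = [a,a+w) × [b,b+h)` and
`Ψ_S R` separated by `j(x) + 1 ≥ 1` gap rows, and a bottom-to-top crossing of `R'` crosses its full-width
band of height `2h + 1`.  Inputs in hand: paired symmetrisation (§2) for the conditioning step, reflection
positivity of the free plaquette field w.r.t. `Ψ_S` (mirror gluing `μ(E ∩ ΘE) ≥ μ(E)²`), the exact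
row-Markov property, `ρ = 7 − 4√3` decorrelation for admissibility; open point: the junction (α).
Threshold form (absorbs admissibility errors and tiny boxes).
  A statement to be proved (registered stub / skeleton glue), not asserted here. -/
def ShearedMirrorDoubling : Prop :=
  ∀ c₀ : ℝ, 0 < c₀ → ∃ c₁ : ℝ, 0 < c₁ ∧ ∀ (S : Set ℤ) (a b : ℤ) (w h : ℕ), 2 ≤ w → 1 ≤ h →
    c₀ ≤ pTB S a b w h → c₁ ≤ pTB S a b w (2 * h + 1)

/-- RSW FOR ISOTROPIC-PURE BOXES AT EVERY ASPECT RATIO, both directions, every position and every pattern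
`S` making the box isotropic-pure — derived in §5 from stubs 1–4 and 6 (`isotropicRSW_of`).
  A statement derived in the skeleton glue (`isotropicRSW_of`), not asserted here. -/
def IsotropicRSW : Prop :=
  ∀ k : ℕ, ∃ c : ℝ, 0 < c ∧
    (∀ (S : Set ℤ) (a b : ℤ) (w h : ℕ), 2 ≤ h → h ≤ w → w ≤ k * h → IsoCols S a w → c ≤ pLR S a b w h) ∧
    (∀ (S : Set ℤ) (a b : ℤ) (w h : ℕ), 2 ≤ w → w ≤ h → h ≤ k * w → IsoCols S a w → c ≤ pTB S a b w h)

/-- STUB 7 statement — THE `∀S` LAYER: from RSW of the two pure media and the all-`S` vertical doubling,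
SQUARES are crossed vertically (hence, by duality, both ways) and WIDE boxes horizontally, uniformly in the
pattern.  Live content: an FKG-free gluing of crossings of overlapping boxes for the Markov plaquette field
(the same junction technology as stub 6; given it, wide ⇐ squares + tall by the five-box construction) and
the square non-degeneracy ("no unbounded effective anisotropy of a columnar mixture of two self-dual media").
Numerically squares lie in `[0.47, 0.53]` and long-way probabilities in `[0.13, 0.23]` for every pattern
tested up to `n = 256` (Disproof §5).
  A statement to be proved (registered stub / skeleton glue), not asserted here. -/
def PatternLayer : Prop :=
  IsotropicRSW → HoneycombRSW → ShearedMirrorDoubling →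
    ∃ c : ℝ, 0 < c ∧ ∀ (S : Set ℤ) (n : ℕ) (a b : ℤ),
      (1 ≤ n → c ≤ pLR S a b (2 * n) n) ∧ (2 ≤ n → c ≤ pTB S a b n n)

/-! ## §5 Proved glue -/

/-- Width reached after `k` doublings of a square of side `h`: `dblWidth 0 h = h`,
`dblWidth (k+1) h = 2 · dblWidth k h + 1` (`= 2^k (h+1) − 1`). -/
def dblWidth : ℕ → ℕ → ℕ
  | 0, h => h
  | k + 1, h => 2 * dblWidth k h + 1

/-- No doubling leaves the side unchanged. -/
@[simp] theorem dblWidth_zero (h : ℕ) : dblWidth 0 h = h := rfl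

/-- One more doubling: `2 · (previous) + 1` (the fat axis row). -/
@[simp] theorem dblWidth_succ (k h : ℕ) : dblWidth (k + 1) h = 2 * dblWidth k h + 1 := rfl

/-- `k` doublings reach aspect ratio at least `k + 1`. -/
theorem succ_mul_le_dblWidth (k h : ℕ) : (k + 1) * h ≤ dblWidth k h := by
  induction k with
  | zero => simp
  | succ k ih =>
    rw [dblWidth_succ]
    have h1 : (k + 1 + 1) * h = (k + 1) * h + h := by ring
    have h2 : h ≤ (k + 1) * h := Nat.le_mul_of_pos_left h (Nat.succ_pos k)
    omega

/-- Isotropic-pure boxes have the crossing probabilities of the `S = univ` box at the origin (stub 1). -/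
theorem iso_recentre (hL : PatternLocality) {S : Set ℤ} {a : ℤ} {w : ℕ} (hiso : IsoCols S a w) (b : ℤ)
    (h : ℕ) : pLR S a b w h = pLR Set.univ 0 0 w h ∧ pTB S a b w h = pTB Set.univ 0 0 w h :=
  hL S Set.univ a 0 b 0 w h fun i hi =>
    ⟨fun _ => Set.mem_univ _, fun _ => hiso (a + i) (by omega) (by omega)⟩

/-- Recentring at `S = univ` (stub 1). -/
theorem univ_recentre (hL : PatternLocality) (a b : ℤ) (w h : ℕ) :
    pLR Set.univ a b w h = pLR Set.univ 0 0 w h ∧ pTB Set.univ a b w h = pTB Set.univ 0 0 w h :=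
  hL Set.univ Set.univ a 0 b 0 w h fun _ _ => ⟨fun _ => Set.mem_univ _, fun _ => Set.mem_univ _⟩

/-- The quarter turn, recentred: `P_univ[TB(w × h)] = P_univ[LR(h × w)]` at the origin (stubs 3 + 1). -/
theorem pTB_univ_eq_pLR_univ (hL : PatternLocality) (hQ : QuarterTurn) (w h : ℕ) :
    pTB Set.univ 0 0 w h = pLR Set.univ 0 0 h w := by
  rw [hQ w h, (univ_recentre hL _ _ _ _).1]

/-- The EXACT square value of the isotropic model: `P_univ[LR(n × n)] = 1/2` for `n ≥ 2`
(duality, stub 2, + quarter turn, stubs 3 + 1). -/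
theorem pLR_square_univ (hL : PatternLocality) (hD : Duality) (hQ : QuarterTurn) {n : ℕ} (hn : 2 ≤ n) :
    pLR Set.univ 0 0 n n = 1 / 2 := by
  have h1 := hD Set.univ 0 0 n n hn hn
  have h2 := pTB_univ_eq_pLR_univ hL hQ n n
  linarith

/-- The same for the vertical direction. -/
theorem pTB_square_univ (hL : PatternLocality) (hD : Duality) (hQ : QuarterTurn) {n : ℕ} (hn : 2 ≤ n) :
    pTB Set.univ 0 0 n n = 1 / 2 := by
  rw [pTB_univ_eq_pLR_univ hL hQ, pLR_square_univ hL hD hQ hn]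

/-- Iterating the lever VERTICALLY at `S = univ`: after `k` doublings the `h × dblWidth k h` boxes of the
isotropic model are BT-crossed with probability `≥ c_k > 0`, uniformly in `h ≥ 2` (stub 6 at `S = univ`). -/
theorem pTB_dblWidth_univ (hL : PatternLocality) (hD : Duality) (hQ : QuarterTurn)
    (hE : ShearedMirrorDoubling) :
    ∀ k : ℕ, ∃ c : ℝ, 0 < c ∧ ∀ h : ℕ, 2 ≤ h → c ≤ pTB Set.univ 0 0 h (dblWidth k h) := by
  intro k
  induction k with
  | zero =>
    refine ⟨1 / 2, by norm_num, fun h hh => ?_⟩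
    rw [dblWidth_zero, pTB_square_univ hL hD hQ hh]
  | succ k ih =>
    obtain ⟨c, hc, hk⟩ := ih
    obtain ⟨c', hc', hstep⟩ := hE c hc
    refine ⟨c', hc', fun h hh => ?_⟩
    rw [dblWidth_succ]
    have hw : 1 ≤ dblWidth k h := by
      have h1 := succ_mul_le_dblWidth k h
      have h2 : h ≤ (k + 1) * h := Nat.le_mul_of_pos_left h (Nat.succ_pos k)
      omega
    exact hstep Set.univ 0 0 h (dblWidth k h) hh hw (hk h hh)

/-- Stubs 1–4 and 6 give RSW for isotropic-pure boxes at every aspect ratio, both directions, every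
position. -/
theorem isotropicRSW_of (hL : PatternLocality) (hD : Duality) (hQ : QuarterTurn) (hM : Monotone')
    (hE : ShearedMirrorDoubling) : IsotropicRSW := by
  intro k
  obtain ⟨c, hc, hk⟩ := pTB_dblWidth_univ hL hD hQ hE k
  have key : ∀ w h : ℕ, 2 ≤ w → w ≤ h → h ≤ k * w → c ≤ pTB Set.univ 0 0 w h := by
    intro w h hw hwh hhk
    have hle : h ≤ dblWidth k w := by
      have h1 := succ_mul_le_dblWidth k w
      have h2 : k * w ≤ (k + 1) * w := Nat.mul_le_mul_right w (Nat.le_succ k)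
      omega
    calc c ≤ pTB Set.univ 0 0 w (dblWidth k w) := hk w hw
      _ ≤ pTB Set.univ 0 0 w h := hM.2 Set.univ 0 0 w h (dblWidth k w) (by omega) hle
  refine ⟨c, hc, ?_, ?_⟩
  · intro S a b w h hh hhw hwk hiso
    rw [(iso_recentre hL hiso b h).1, ← pTB_univ_eq_pLR_univ hL hQ h w]
    exact key h w hh hhw hwk
  · intro S a b w h hw hwh hhk hiso
    rw [(iso_recentre hL hiso b h).2]
    exact key w h hw hwh hhk

/-- Stubs 5 + 1 give RSW for honeycomb-pure boxes. -/
theorem honeycombRSW_of (hL : PatternLocality) (hH : PatternLocality → HoneycombRSW) : HoneycombRSW := hH hL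

/-! ### The `n = 1` datum (Disproof §3, landed `Negative.pH_one_zero_zero`) -/

section NOne

open Summit.CriticalPhenomena.CardyFormulaZ2.Theorems.IKMixedBoxCrossing.Negative (pH pV pH_one_zero_zero)

/-- The aspect-2 probabilities of this file ARE the disprover's `pH`/`pV` (definitional unfolding). -/
theorem pLR_two_mul_eq_pH (S : Set ℤ) (n : ℕ) (a b : ℤ) : pLR S a b (2 * n) n = pH S n a b := by
  simp only [pLR, pH, lrCross, obs, blackEdges, blackSet, antiSet, parSet, μIK,
    Summit.CriticalPhenomena.CardyFormulaZ2.Theorems.IKMixedBoxCrossing.Negative.hEvent,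
    Summit.CriticalPhenomena.CardyFormulaZ2.Theorems.IKMixedBoxCrossing.Negative.edges,
    Summit.CriticalPhenomena.CardyFormulaZ2.Theorems.IKMixedBoxCrossing.Negative.blackSet,
    Summit.CriticalPhenomena.CardyFormulaZ2.Theorems.IKMixedBoxCrossing.Negative.antiSet,
    Summit.CriticalPhenomena.CardyFormulaZ2.Theorems.IKMixedBoxCrossing.Negative.parSet,
    Summit.CriticalPhenomena.CardyFormulaZ2.Theorems.IKMixedBoxCrossing.Negative.μIK,
    Set.preimage_setOf_eq, Set.mem_setOf_eq, Nat.cast_mul, Nat.cast_ofNat]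

/-- The tall aspect-2 probability of this file is the disprover's `pV` (definitional unfolding). -/
theorem pTB_two_mul_eq_pV (S : Set ℤ) (n : ℕ) (a b : ℤ) : pTB S a b n (2 * n) = pV S n a b := by
  simp only [pTB, pV, tbCross, obs, blackEdges, blackSet, antiSet, parSet, μIK,
    Summit.CriticalPhenomena.CardyFormulaZ2.Theorems.IKMixedBoxCrossing.Negative.vEvent,
    Summit.CriticalPhenomena.CardyFormulaZ2.Theorems.IKMixedBoxCrossing.Negative.edges,
    Summit.CriticalPhenomena.CardyFormulaZ2.Theorems.IKMixedBoxCrossing.Negative.blackSet,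
    Summit.CriticalPhenomena.CardyFormulaZ2.Theorems.IKMixedBoxCrossing.Negative.antiSet,
    Summit.CriticalPhenomena.CardyFormulaZ2.Theorems.IKMixedBoxCrossing.Negative.parSet,
    Summit.CriticalPhenomena.CardyFormulaZ2.Theorems.IKMixedBoxCrossing.Negative.μIK,
    Set.preimage_setOf_eq, Set.mem_setOf_eq, Nat.cast_mul, Nat.cast_ofNat]

/-- `P_univ[LR(2 × 1)] = 1/4` at the origin (the disprover's tightness datum). -/
theorem pLR_univ_two_one : pLR Set.univ 0 0 2 1 = 1 / 4 := by
  have h := pLR_two_mul_eq_pH Set.univ 1 0 0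
  rw [Nat.mul_one] at h
  rw [h, pH_one_zero_zero]

/-- The `n = 1` tall datum, every `S`: `P_S[TB(1 × 2 at (a,b))] ≥ min (1/4) c_hc` — through the quarter
turn when the column `a` is isotropic, through the honeycomb member otherwise. -/
theorem pTB_one_two_ge (hL : PatternLocality) (hQ : QuarterTurn) {c : ℝ}
    (hH : ∀ (S : Set ℤ) (n : ℕ) (a b : ℤ), 1 ≤ n →
      (HcCols S a (2 * n) → c ≤ pLR S a b (2 * n) n) ∧ (HcCols S a n → c ≤ pTB S a b n (2 * n)))
    (S : Set ℤ) (a b : ℤ) : min (1 / 4) c ≤ pTB S a b 1 2 := by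
  by_cases ha : a ∈ S
  · have hiso : IsoCols S a 1 := fun x hx hx' => by
      have : x = a := by omega
      rw [this]; exact ha
    rw [(iso_recentre hL hiso b 2).2, pTB_univ_eq_pLR_univ hL hQ 1 2, pLR_univ_two_one]
    exact min_le_left _ _
  · have hhc : HcCols S a 1 := fun x hx hx' => by
      have : x = a := by omega
      rw [this]; exact ha
    have h := (hH S 1 a b le_rfl).2 hhc
    rw [Nat.mul_one] at h
    exact (min_le_right _ _).trans h

end NOne

/-! ## §6 The composition: the seven stubs imply the crux, BY NAME (both copies of the decl) -/

/-- The named form of the crux from the seven statements. -/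
theorem namedForm_of (h1 : PatternLocality) (h2 : Duality) (h3 : QuarterTurn) (h4 : Monotone')
    (h5 : PatternLocality → HoneycombRSW) (h6 : ShearedMirrorDoubling) (h7 : PatternLayer) :
    ∃ c : ℝ, 0 < c ∧ ∀ S : Set ℤ, ∀ n : ℕ, 1 ≤ n → ∀ a b : ℤ,
      c ≤ pLR S a b (2 * n) n ∧ c ≤ pTB S a b n (2 * n) := by
  have hIso : IsotropicRSW := isotropicRSW_of h1 h2 h3 h4 h6
  obtain ⟨cH, hcH, hH⟩ := honeycombRSW_of h1 h5
  obtain ⟨c7, hc7, hL7⟩ := h7 hIso ⟨cH, hcH, hH⟩ h6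
  -- tall clause for `n ≥ 2`: squares (stub 7) ▸ one vertical doubling (stub 6) ▸ monotonicity (stub 4)
  obtain ⟨c6, hc6, hT⟩ := h6 c7 hc7
  refine ⟨min (min c7 c6) (min (1 / 4) cH), lt_min (lt_min hc7 hc6) (lt_min (by norm_num) hcH), ?_⟩
  intro S n hn a b
  refine ⟨?_, ?_⟩
  · exact ((min_le_left _ _).trans (min_le_left _ _)).trans ((hL7 S n a b).1 hn)
  · rcases Nat.lt_or_ge n 2 with hlt | hge
    · have : n = 1 := by omega
      subst this
      exact (min_le_right _ _).trans (pTB_one_two_ge h1 h3 hH S a b)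
    · have hsq : c7 ≤ pTB S a b n n := (hL7 S n a b).2 hge
      have hdbl : c6 ≤ pTB S a b n (2 * n + 1) := hT S a b n n hge (by omega) hsq
      have hmono : pTB S a b n (2 * n + 1) ≤ pTB S a b n (2 * n) := h4.2 S a b n (2 * n) (2 * n + 1) (by omega) (by omega)
      exact ((min_le_left _ _).trans (min_le_right _ _)).trans (hdbl.trans hmono)

/-- **COMPOSITION** (kernel-checked, no `sorry`; a CONDITIONAL theorem crediting nothing by itself): the seven
registered stub statements of the line `paired-mirror-exploration` imply the item's HOME decl
`CardyDiluteOrbit.IKMixedBoxCrossing` by name.  The lead's skeleton instantiates it with the seven `stub_*`. -/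
theorem IKMixedBoxCrossing_of_stubs :
    PatternLocality → Duality → QuarterTurn → Monotone' → (PatternLocality → HoneycombRSW) →
      ShearedMirrorDoubling → PatternLayer →
        Summit.CriticalPhenomena.CardyFormulaZ2.Theses.CardyDiluteOrbit.IKMixedBoxCrossing :=
  fun h1 h2 h3 h4 h5 h6 h7 => iff_cbox.2 (namedForm_of h1 h2 h3 h4 h5 h6 h7)

/-- The same composition concluding the payload-route copy `CardyIKTransport.IKMixedBoxCrossing` by name. -/
theorem IKMixedBoxCrossing_transport_of_stubs (h1 : PatternLocality) (h2 : Duality) (h3 : QuarterTurn)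
    (h4 : Monotone') (h5 : PatternLocality → HoneycombRSW) (h6 : ShearedMirrorDoubling) (h7 : PatternLayer) :
    Summit.CriticalPhenomena.CardyFormulaZ2.Theses.CardyIKTransport.IKMixedBoxCrossing :=
  iff_cbox_transport.2 (namedForm_of h1 h2 h3 h4 h5 h6 h7)


end Summit.CriticalPhenomena.CardyFormulaZ2.Cruxes.IKMixedBoxCrossing.PairedMirrorExploration

end
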